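import Summits.BirchSwinnertonDyer.BirchSwinnertonDyer.Theorems.KimAtThreeFineKatoKPortResidueNorm
import Summits.BirchSwinnertonDyer.BirchSwinnertonDyer.Theorems.KimAtThreeFineKatoSATPoints
import Literature.NumberTheory.EllipticCurves.VariableChangePointsMap
import Literature.NumberTheory.EllipticCurves.EichlerShimuraCongruenceHondaProofs
import HarnessLib

/-!
# K-PORT: the E-side of the per-factor Kato package's LOG-LATTICE CLAUSE (d) at an abstract unramified
# `K ⊇ ℚ₃` — **`∃ P ∈ E₀(K), ‖Tr_{K/ℚ₃}(Λ̃ P)‖ = 1` and `‖Λ̃‖ ≤ 1` on `E₀(K)`** on the Kato stratum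
# (cell `bsd-addord`, seat w2-acc4 gen 4; `--supports stmt-BirchSwinnertonDyer-19560`, helper)

HONEST FRAMING. Route W2 (`route-BirchSwinnertonDyer-KimAtThreeKolyvagin`), crux 19560
`KatoKuriharaPortThreeShared`, residual ⟨C1⟩ clause (C1.c) / per-factor package `hKloc` clause (d)
(kim3 memo KIM3-W2-C1c-SEMILOCAL-g14 §2: "per factor `w ∣ 3`: `Λ₀ʷ ⊆ 𝒪_w` with `0 ∈ Λ₀ʷ`, and ONE
`w₀` with `ℓ₀ ∈ Λ₀^{w₀}`, `‖e₃⁻¹ Tr(ℓ₀)‖ = 1` — intended `Λ₀ʷ := Λ̃″E₀(L_w)`").  kim3's brief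
KIM3-KPORT-BRIEF-g12 §3 asked for the CONSUMER THEOREM `∃ P ∈ E₀(K), Tr_{K/ℚ₃}(log P) ∈ ℤ₃ˣ ∧
∀ Q ∈ E₀(K), ‖log Q‖ ≤ 1`.  kport gen 0 proved it up to (i) the residue-field input `hres` and (ii)
kim3's step (δ) at `ℚ₃`; `…KPortResidueNorm` (this seat) discharged (i) (`KPort.consumer_of_addv`:
`Tr(Λ̃ P) = padicLog X P₀` with `P₀ ∈ E₀(ℚ₃) ∖ E₁(ℚ₃)`).  This file performs the last inch (ii) at
the ABSTRACT `K`: on the Kato stratum (`Addv W 3`, `E(ℚ₃)[3] = 0` in the crux's form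
`#{Q : 3 • Q = 0} = 1`), kim3's (δ) `KimAtThreeFineKatoSATPoints.mem_formalFiltration_zero_of_norm_padicLog_le`
(`λ_{ℚ₃} : E₀(ℚ₃)/E₁(ℚ₃) → ℤ₃/3ℤ₃` injective) turns `P₀ ∉ E₁(ℚ₃)` into `‖padicLog X P₀‖ = 1`
(`≤ 1` because `ι P₀ = N(P) ∈ E₀(K)` and `Λ̃(ι P₀) = padicLog X P₀`; `≥ 1` because `‖·‖ < 1` on `ℚ₃`
means `≤ 3⁻¹`).  Result `exists_norm_trace_satLog_eq_one_of_addv`: the brief's consumer theorem in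
the UNIT form, for every `W/ℚ` globally minimal with `Addv W 3` and `E(ℚ₃)[3] = 0` and every finite
Galois, complete, ultrametric, unramified normed `ℚ₃`-algebra field `K` — the E-side data of
clause (d) at EACH factor (the junction `K := L_w`, i.e. the normed-`ℚ₃`-algebra structure on the
completions and (J1)–(J3) of kim3's memo §3, is w2-kport's (T5) and is NOT done here).  TOOL theorems
only (no definition, no named fact, no `sorry`); closes nothing; nothing booked; BSD is not proved.

## What is proved (`M = W_ℤ ⊗ ℤ₃`, `X = M ⊗ ℚ₃`, `E = curveK 3 K M`, `E₀(K)`, `Λ̃ = satLog 3 K M`)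

* `natCard_torsion_eq_of_eq` — `#{Q : 3 • Q = 0}` is the same for `X` and for `W.baseChange ℚ_[3]`
  (the two models are EQUAL curves, tree `map_coe_integralModelInt`; transport along
  `Affine.Point.congrEquiv`), so the crux's binder `#E(ℚ₃)[3] = 1` feeds kim3's (δ) for `X`.
* `norm_padicLog_eq_one_of_not_isInReductionKernel` — (δ) in norm form: on the Kato stratum a point
  `P₀ ∈ E₀(ℚ₃) ∖ E₁(ℚ₃)` with `‖padicLog X P₀‖ ≤ 1` has `‖padicLog X P₀‖ = 1`.
* **`exists_norm_trace_satLog_eq_one_of_addv`** — `(∃ P ∈ E₀(K), ‖Tr_{K/ℚ₃}(Λ̃ P)‖ = 1) ∧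
  ∀ Q ∈ E₀(K), ‖Λ̃ Q‖ ≤ 1`.

References: C.-H. Kim, *AJM* 148 (2026) Lemma 3.10/3.11 [Kim2022StructureSelmer]; J. H. Silverman,
*AEC* 2nd ed. (2009) IV.6.4, VII.2.1–2.2 [SilvermanAEC2009]; kim3 memos KIM3-KPORT-BRIEF-g12 §3,
KIM3-W2-C1c-SEMILOCAL-g14 §2 (d), §3.
-/

noncomputable section

-- the cell's Theorems namespace `Summit.BirchSwinnertonDyer.BirchSwinnertonDyer.…` repeats the summit name by design (D-0017)
set_option linter.dupNamespace false

open scoped Classical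

namespace Summit.BirchSwinnertonDyer.BirchSwinnertonDyer.Theorems.KPort

open Summit.BirchSwinnertonDyer.Rank1Residual.Additive
open Summit.BirchSwinnertonDyer.Rank1Residual.Additive.BallEval
open Summit.BirchSwinnertonDyer.Rank1Residual.Additive.LocalLog
open Summit.BirchSwinnertonDyer.BirchSwinnertonDyer.Theorems.KimAtThreeFineKatoSATPoints
open Literature.NumberTheory.GaloisRepresentations.LubinTate (unitBall mem_unitBall_iff)
open Literature.NumberTheory.EllipticCurves Literature.NumberTheory.EllipticCurves.FormalGroupChart
open Literature.NumberTheory.EllipticCurves.Rank1Residual WeierstrassCurve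

/-! ## §1 Transport of the torsion binder and (δ) in norm form, on `ℚ₃`-points -/

section Padic

/-- In `ℚ_p`, `‖x‖ < 1` forces `‖x‖ ≤ p⁻¹` (the value group is `p^ℤ`). [folklore] -/
private theorem norm_le_inv_of_norm_lt_one {p : ℕ} [hp : Fact p.Prime] {x : ℚ_[p]} (h : ‖x‖ < 1) :
    ‖x‖ ≤ (p : ℝ)⁻¹ := by
  by_cases hx : x = 0
  · rw [hx, norm_zero]; exact inv_nonneg.mpr (by positivity)
  have hp1 : (1 : ℝ) < p := by exact_mod_cast hp.out.one_lt
  rw [Padic.norm_eq_zpow_neg_valuation hx] at h ⊢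
  have hv : 0 < x.valuation := by
    by_contra hle
    push Not at hle
    have : (1 : ℝ) ≤ (p : ℝ) ^ (-x.valuation) := one_le_zpow₀ hp1.le (by omega)
    exact absurd h (not_lt.mpr this)
  rw [← zpow_neg_one]
  exact zpow_le_zpow_right₀ hp1.le (by omega)

/-- The number of `n`-torsion points is invariant under an EQUALITY of Weierstrass curves (transport
along the tree's `Affine.Point.congrEquiv`). [folklore] -/
theorem natCard_torsion_eq_of_eq {F : Type*} [Field F] {W₁ W₂ : WeierstrassCurve F} (h : W₁ = W₂)
    (n : ℕ) :
    Nat.card {Q : W₁.toAffine.Point // n • Q = 0} = Nat.card {Q : W₂.toAffine.Point // n • Q = 0} := by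
  subst h
  rfl

variable (W : WeierstrassCurve ℚ) [W.IsElliptic] [W.IsGloballyMinimal]

omit [W.IsElliptic] in
/-- The crux's torsion binder `#{Q ∈ E(ℚ₃) : 3 • Q = 0} = 1`, stated on `W.baseChange ℚ_[3]`, holds
verbatim for the K-port's model `X = (W_ℤ ⊗ ℤ₃) ⊗ ℚ₃` (the SAME curve: `map_coe_integralModelInt`).
[folklore] -/
theorem natCard_torsion_coe_integralModelInt_eq (n : ℕ) :
    Nat.card {Q : (((integralModelInt W).map (Int.castRingHom ℤ_[3])).map
        PadicInt.Coe.ringHom).toAffine.Point // n • Q = 0} =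
      Nat.card {Q : (W.baseChange ℚ_[3]).toAffine.Point // n • Q = 0} :=
  natCard_torsion_eq_of_eq (map_coe_integralModelInt (p := 3) W) n

/-- **(δ) in norm form on the Kato stratum** (`Addv W 3`, `E(ℚ₃)[3] = 0`): a point `P₀` of
`E₀(ℚ₃)` (`X.goodReductionSubgroup ℤ_[3]`) NOT in `E₁(ℚ₃)` (`¬ X.IsInReductionKernel P₀`) whose
logarithm is `3`-integral has `‖padicLog X P₀‖ = 1` — by kim3's
`mem_formalFiltration_zero_of_norm_padicLog_le` (`‖log P₀‖ ≤ 3⁻¹ ⇒ P₀ ∈ E₁`) and `‖·‖ < 1 ⇒ ≤ 3⁻¹`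
on `ℚ₃`. [cite: Kim2022StructureSelmer, §3.3 Lemma 3.11 (first line)] -/
theorem norm_padicLog_eq_one_of_not_isInReductionKernel (hadd : Addv W 3)
    [(((integralModelInt W).map (Int.castRingHom ℤ_[3])).map PadicInt.Coe.ringHom).IsElliptic]
    [(((integralModelInt W).map (Int.castRingHom ℤ_[3])).map PadicInt.Coe.ringHom).IsIntegral ℤ_[3]]
    [(((integralModelInt W).map (Int.castRingHom ℤ_[3])).map PadicInt.Coe.ringHom).IsMinimal ℤ_[3]]
    (ht : Nat.card {Q : (W.baseChange ℚ_[3]).toAffine.Point // (3 : ℕ) • Q = 0} = 1)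
    {P₀ : (((integralModelInt W).map (Int.castRingHom ℤ_[3])).map PadicInt.Coe.ringHom).toAffine.Point}
    (hP₀ : P₀ ∈ (((integralModelInt W).map (Int.castRingHom ℤ_[3])).map PadicInt.Coe.ringHom).goodReductionSubgroup
      ℤ_[3])
    (hker : ¬ (((integralModelInt W).map (Int.castRingHom ℤ_[3])).map PadicInt.Coe.ringHom).IsInReductionKernel P₀)
    (hle : ‖padicLog (((integralModelInt W).map (Int.castRingHom ℤ_[3])).map PadicInt.Coe.ringHom) P₀‖ ≤ 1) :
    ‖padicLog (((integralModelInt W).map (Int.castRingHom ℤ_[3])).map PadicInt.Coe.ringHom) P₀‖ = 1 := by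
  haveI : (((integralModelInt W).map (Int.castRingHom ℤ_[3])).map PadicInt.Coe.ringHom).HasAdditiveReduction
      ℤ_[3] := by
    rw [map_coe_integralModelInt]
    exact LocalLog.hasAdditiveReduction_baseChange_padic_of_addv W 3 hadd
  have ht' : Nat.card {Q : (((integralModelInt W).map (Int.castRingHom ℤ_[3])).map
      PadicInt.Coe.ringHom).toAffine.Point // (3 : ℕ) • Q = 0} = 1 := by
    rw [natCard_torsion_coe_integralModelInt_eq W 3]; exact ht
  by_contra hne
  have hle3 := norm_le_inv_of_norm_lt_one (lt_of_le_of_ne hle hne)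
  have hmem := mem_formalFiltration_zero_of_norm_padicLog_le
    (((integralModelInt W).map (Int.castRingHom ℤ_[3])).map PadicInt.Coe.ringHom) rfl
    (forall_p_nsmul_eq_zero_of_natCard_eq_one _ ht') hP₀ hle3
  exact hker ((WeierstrassCurve.mem_formalFiltration_zero_iff _).mp hmem)

end Padic

/-! ## §2 The unit-trace point over an abstract unramified `K ⊇ ℚ₃` -/

section Unit

variable {K : Type*} [NontriviallyNormedField K] [NormedAlgebra ℚ_[3] K] [IsUltrametricDist K]
  [CompleteSpace K] [FiniteDimensional ℚ_[3] K] [IsGalois ℚ_[3] K]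
  (W : WeierstrassCurve ℚ) [W.IsElliptic] [W.IsGloballyMinimal]
  [hint : (curveK 3 K ((integralModelInt W).map (Int.castRingHom ℤ_[3]))).IsIntegral
    (NormedField.valuation (K := K)).integer]
  [hE : (((integralModelInt W).map (Int.castRingHom ℤ_[3])).map PadicInt.Coe.ringHom).IsElliptic]
  [hX : (((integralModelInt W).map (Int.castRingHom ℤ_[3])).map PadicInt.Coe.ringHom).IsIntegral ℤ_[3]]
  [hX' : (((integralModelInt W).map (Int.castRingHom ℤ_[3])).map PadicInt.Coe.ringHom).IsIntegral
    (NormedField.valuation (K := ℚ_[3])).integer]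
  [hmin : (((integralModelInt W).map (Int.castRingHom ℤ_[3])).map PadicInt.Coe.ringHom).IsMinimal ℤ_[3]]

/-- **kim3's CONSUMER THEOREM in UNIT form, all hypotheses discharged at the abstract `K`** (the
E-side of `hKloc` clause (d) at one factor).  `W/ℚ` globally minimal with `Addv W 3` and
`#{Q ∈ E(ℚ₃) : 3 • Q = 0} = 1` (Kato stratum); `K/ℚ₃` finite Galois, complete, ultrametric,
UNRAMIFIED (`‖x‖ < 1 → ‖x‖ ≤ ‖3‖`).  Then with `Λ̃ = KPort.satLog` (Galois-equivariant, `= padicLog`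
on `ℚ₃`-points): **some `P ∈ E₀(K)` has `‖Tr_{K/ℚ₃}(Λ̃ P)‖ = 1`, and `‖Λ̃ Q‖ ≤ 1` for every
`Q ∈ E₀(K)`** — i.e. `Λ₀ := Λ̃″E₀(K) ⊆ 𝒪_K` contains an element of unit trace.  (`KPort.consumer_of_addv`
∘ `norm_padicLog_eq_one_of_not_isInReductionKernel`; `‖padicLog X P₀‖ ≤ 1` from
`Λ̃(ι P₀) = padicLog X P₀` and `ι P₀ = N(P) ∈ E₀(K)`.)
[cite: Kim2022StructureSelmer, §3.3 Lemma 3.10–3.11] [cite: SilvermanAEC2009, IV.6.4 and VII.2.1–2.2] -/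
theorem exists_norm_trace_satLog_eq_one_of_addv (hadd : Addv W 3)
    (hK : ∀ x : K, ‖x‖ < 1 → ‖x‖ ≤ ‖((3 : ℕ) : K)‖)
    (ht : Nat.card {Q : (W.baseChange ℚ_[3]).toAffine.Point // (3 : ℕ) • Q = 0} = 1) :
    (∃ P ∈ (((integralModelInt W).map (Int.castRingHom ℤ_[3])).map (coeffHom 3 K)).nonsingularReductionSubgroup
        (Valuation.integer.integers (NormedField.valuation (K := K))),
      ‖Algebra.trace ℚ_[3] K (satLog 3 K ((integralModelInt W).map (Int.castRingHom ℤ_[3])) P)‖ = 1) ∧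
    ∀ Q ∈ (((integralModelInt W).map (Int.castRingHom ℤ_[3])).map (coeffHom 3 K)).nonsingularReductionSubgroup
        (Valuation.integer.integers (NormedField.valuation (K := K))),
      ‖satLog 3 K ((integralModelInt W).map (Int.castRingHom ℤ_[3])) Q‖ ≤ 1 := by
  obtain ⟨⟨P, hP, P₀, hP₀, hker, hι, htr⟩, hle⟩ := consumer_of_addv (K := K) W hadd hK
  refine ⟨⟨P, hP, ?_⟩, hle⟩
  rw [htr]
  -- `‖padicLog X P₀‖ ≤ 1`: `ι P₀ = N(P) ∈ E₀(K)` and `Λ̃(ι P₀) = padicLog X P₀`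
  have hN : Affine.Point.map
      (W' := (((integralModelInt W).map (Int.castRingHom ℤ_[3])).map PadicInt.Coe.ringHom).toAffine)
      (Algebra.ofId ℚ_[3] K) P₀ ∈
      (((integralModelInt W).map (Int.castRingHom ℤ_[3])).map (coeffHom 3 K)).nonsingularReductionSubgroup
        (Valuation.integer.integers (NormedField.valuation (K := K))) := by
    rw [hι]; exact sum_galois_mem_nonsingularReductionSubgroup hP
  have h1 : ‖padicLog (((integralModelInt W).map (Int.castRingHom ℤ_[3])).map PadicInt.Coe.ringHom) P₀‖ ≤ 1 := by
    have h := hle _ hN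
    rwa [satLog_map_ofId, norm_algebraMap'] at h
  exact norm_padicLog_eq_one_of_not_isInReductionKernel W hadd ht hP₀ hker h1

end Unit

end Summit.BirchSwinnertonDyer.BirchSwinnertonDyer.Theorems.KPort

end
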